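import Summits.BirchSwinnertonDyer.BirchSwinnertonDyer.Theorems.Rank2Observatory2DescAdmKernel
import HarnessLib

/-!
# BirchSwinnertonDyer — rank ≥ 2 observatory: the residue form of the standard admissibility test

HONEST FRAMING: per-curve certified theorems and census instruments; no claim on BSD in rank ≥ 2.

Generic addendum of the KERNEL-2DESC instrument (design `b2b-bsdr2-cert-3/KERNEL-2DESC.md` §4
A4/A6, production stage S4). The bounded square search of `admStdK B` is linear in `B`, hence
unusable once the product of the generator norms is large (degree-`2`/`3` primes: `|N| = p², p³`).
`admStdQ Q` replaces the square test by the necessary condition "`z` is a square residue modulo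
every `q ∈ Q`" for a per-curve list `Q` of small moduli (chosen by the generator so that every
non-square product of norms is obstructed); the kernel evaluates it in time `O(#pairs · Σ q)`.
`admStdQ_of_admStd` transfers soundness from `admStd_sound`; `admStdQ_empty` is the trivial pair.

Sorry-free; axioms `propext`, `Classical.choice`, `Quot.sound`. [folklore]
-/

-- single-conjunct summit: `Summit.BirchSwinnertonDyer.BirchSwinnertonDyer.…` repeats the name by design
set_option linter.dupNamespace false

noncomputable section

open scoped Classical NumberField

open Literature.NumberTheory.NumberFields

namespace Summit.BirchSwinnertonDyer.BirchSwinnertonDyer.Rank2Observatory.TwoDescCubic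

variable {m s : ℕ}

/-- `z` is a square residue modulo `q` (witness `r < q` with `r·r ≡ z`). Kernel-decidable. [folklore] -/
def sqResidue (q : ℕ) (z : ℤ) : Bool :=
  decide (∃ r : Fin q, (((r : ℕ) * (r : ℕ) : ℕ) : ℤ) % (q : ℤ) = z % (q : ℤ))

/-- A square is a square residue modulo every `q > 0`. [folklore] -/
theorem sqResidue_of_isSquare {q : ℕ} (hq : 0 < q) {z : ℤ} (hz : IsSquare z) :
    sqResidue q z = true := by
  obtain ⟨t, ht⟩ := hz
  rw [sqResidue, decide_eq_true_eq]
  refine ⟨⟨t.natAbs % q, Nat.mod_lt _ hq⟩, ?_⟩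
  have h1 : (((t.natAbs % q : ℕ) : ℤ)) = (t.natAbs : ℤ) % (q : ℤ) := Int.natCast_mod _ _
  have h2 : z = (t.natAbs : ℤ) * (t.natAbs : ℤ) := by
    rw [ht, ← Int.natAbs_mul_self]; push_cast; ring
  simp only [Nat.cast_mul, h1, h2]
  rw [Int.mul_emod, Int.emod_emod_of_dvd _ (dvd_refl _), ← Int.mul_emod]

/-- **Residue form of the standard test**: square-residue test modulo every `q ∈ Q` on the product
of the norms, and the real-sign parity. [folklore] -/
def admStdQ (Q : List ℕ) (Nu : Fin m → ℤ) (Ng : Fin s → ℤ) (su : Fin m → Bool) (sg : Fin s → Bool)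
    (T : Finset (Fin m)) (U : Finset (Fin s)) : Bool :=
  (Q.all fun q => sqResidue q ((∏ i ∈ T, Nu i) * ∏ j ∈ U, Ng j)) &&
    decide (Even ((T.filter fun i => su i = true).card + (U.filter fun j => sg j = true).card))

/-- **Transfer of soundness**: `admStd = true` gives `admStdQ Q = true` (all moduli positive).
[folklore] -/
theorem admStdQ_of_admStd {Q : List ℕ} (hQ : ∀ q ∈ Q, 0 < q) {Nu : Fin m → ℤ} {Ng : Fin s → ℤ}
    {su : Fin m → Bool} {sg : Fin s → Bool} {T : Finset (Fin m)} {U : Finset (Fin s)}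
    (h : admStd Nu Ng su sg T U = true) : admStdQ Q Nu Ng su sg T U = true := by
  rw [admStd, Bool.and_eq_true, decide_eq_true_eq, decide_eq_true_eq] at h
  rw [admStdQ, Bool.and_eq_true, List.all_eq_true, decide_eq_true_eq]
  exact ⟨fun q hq => sqResidue_of_isSquare (hQ q hq) h.1, h.2⟩

/-- `admStdQ Q` admits the trivial pair. [folklore] -/
theorem admStdQ_empty (Q : List ℕ) (hQ : ∀ q ∈ Q, 0 < q) (Nu : Fin m → ℤ) (Ng : Fin s → ℤ)
    (su : Fin m → Bool) (sg : Fin s → Bool) : admStdQ Q Nu Ng su sg ∅ ∅ = true :=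
  admStdQ_of_admStd hQ (admStd_empty Nu Ng su sg)

end Summit.BirchSwinnertonDyer.BirchSwinnertonDyer.Rank2Observatory.TwoDescCubic

end
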